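import Literature.Geometry.Kaehler.ApproxHermitianYangMills
import Literature.Geometry.Kaehler.PluriharmonicLog
import HarnessLib

/-!
# Hermitian holomorphic vector bundles are `C^∞` Hermitian bundles

Layer `Literature/Geometry/Kaehler`. The tree has two Hermitian-bundle carriers on Mathlib's vector
bundle data: `HermitianHolomorphicBundle E F V` (`HermitianHolomorphicBundle.lean`: a HOLOMORPHIC
bundle, `[ContMDiffVectorBundle ω F V 𝓘(ℂ, E)]`, with a smooth Hermitian structure — the Chern
connection, Kobayashi I §4) and `SmoothHermitianBundle E M` (`ApproxHermitianYangMills.lean`: a `C^∞`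
complex bundle, real-`C^∞` transition operators, with a smooth Hermitian structure — the carrier of
`IsApproxHermitianYangMills` and of `SmoothHermitianBundle.chernCharacter`). Every Hermitian holomorphic
bundle is a `C^∞` Hermitian bundle: holomorphic transition functions are real-`C^∞`
(`contMDiffOn_real_coordChangeL`, from Mathlib's `contMDiffOn_coordChangeL` and the tree's
`contMDiffOn_real_of_mdifferentiableOn_complex`, Voisin I Thm. 1.17), and the two smoothness clauses for
`h` coincide. `SmoothHermitianBundle.ofHolomorphic F V h` is that forgetful map (Kobayashi I §4: "Let
`E` be a `C^∞` complex vector bundle … If `E` is a holomorphic vector bundle …" — the holomorphic case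
is a special case), so the Chern character and the approximate Hermitian–Yang–Mills condition apply to
the Hermitian holomorphic bundles of the tree (e.g. the stable bundles of the flexibility crux of
route `HodgeConjecture/HolomorphicDefect`).

## References

* [Kobayashi1987] S. Kobayashi, Differential Geometry of Complex Vector Bundles (1987), Ch. I §1
  (1.15), §4 (4.1).
* [VoisinHodgeI2002] C. Voisin, Hodge Theory and Complex Algebraic Geometry I (2002), §1.2.1 Thm. 1.17.
-/

noncomputable section

open scoped Manifold ContDiff Topology
open Set Bundle Module

namespace Literature.Geometry.Kaehler

universe u

variable {E : Type u} [NormedAddCommGroup E] [NormedSpace ℂ E] [FiniteDimensional ℂ E]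
  {M : Type u} [TopologicalSpace M] [ChartedSpace E M] [IsManifold 𝓘(ℂ, E) ω M]
  [IsManifold 𝓘(ℝ, E) ∞ M]

/-- **Holomorphic transition functions are real-`C^∞`**: for a holomorphic vector bundle (Mathlib's
`ContMDiffVectorBundle ω F V 𝓘(ℂ, E)`: the coordinate changes of the atlas are `ℂ`-analytic on the
overlaps) the coordinate changes are real-`C^∞` on the overlaps, i.e. the bundle is a `C^∞` complex
vector bundle (Kobayashi I §1; holomorphic ⇒ real-analytic ⇒ `C^∞`, Voisin I Thm. 1.17).
[cite: VoisinHodgeI2002, §1.2.1 Thm. 1.17] -/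
theorem contMDiffOn_real_coordChangeL (F : Type u) [NormedAddCommGroup F] [NormedSpace ℂ F]
    [FiniteDimensional ℂ F] (V : M → Type u) [TopologicalSpace (TotalSpace F V)]
    [∀ x, TopologicalSpace (V x)] [∀ x, AddCommGroup (V x)] [∀ x, Module ℂ (V x)] [FiberBundle F V]
    [VectorBundle ℂ F V] [ContMDiffVectorBundle ω F V 𝓘(ℂ, E)] (e e' : Trivialization F (π F V))
    [MemTrivializationAtlas e] [MemTrivializationAtlas e'] :
    ContMDiffOn 𝓘(ℝ, E) 𝓘(ℝ, F →L[ℂ] F) ∞ (fun x : M ↦ (e.coordChangeL ℂ e' x : F →L[ℂ] F))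
      (e.baseSet ∩ e'.baseSet) := by
  haveI : CompleteSpace F := FiniteDimensional.complete ℂ F
  exact contMDiffOn_real_of_mdifferentiableOn_complex
    ((contMDiffOn_coordChangeL (IB := 𝓘(ℂ, E)) (n := ω) (e := e) (e' := e')).mdifferentiableOn (by simp))
    (e.open_baseSet.inter e'.open_baseSet)

/-- **A Hermitian holomorphic vector bundle is a `C^∞` Hermitian bundle** (forget the holomorphic
structure): same model fibre, fibres, atlas and Hermitian structure; the transition operators are
real-`C^∞` because they are holomorphic (`contMDiffOn_real_coordChangeL`), and the smoothness of `h`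
along the frames of the atlas is the same clause in both carriers (`atlasFrame V x₀ x = e_{x₀}.symmₗ ℂ x`).
Kobayashi I §4 (4.1) (Hermitian structures on `C^∞` bundles; the holomorphic case, Prop. (4.9), is a
special case). [cite: Kobayashi1987, I.(4.1)] -/
def SmoothHermitianBundle.ofHolomorphic (F : Type u) [NormedAddCommGroup F] [InnerProductSpace ℂ F]
    [FiniteDimensional ℂ F] (V : M → Type u) [TopologicalSpace (TotalSpace F V)]
    [∀ x, TopologicalSpace (V x)] [∀ x, AddCommGroup (V x)] [∀ x, Module ℂ (V x)] [FiberBundle F V]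
    [VectorBundle ℂ F V] [ContMDiffVectorBundle ω F V 𝓘(ℂ, E)] (h : HermitianHolomorphicBundle E F V) :
    SmoothHermitianBundle E M where
  Fiber := F
  V := V
  contMDiffOn_coordChangeL e e' _ _ := contMDiffOn_real_coordChangeL F V e e'
  metric := ⟨h.inner, h.inner_conj_symm, h.inner_self_pos⟩
  contMDiffOn_metric := h.contMDiffOn_inner

/-- The rank of the `C^∞` Hermitian bundle underlying a Hermitian holomorphic bundle with model fibre
`F` is `dim F` (definitional). [folklore] -/
theorem SmoothHermitianBundle.ofHolomorphic_rank (F : Type u) [NormedAddCommGroup F]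
    [InnerProductSpace ℂ F] [FiniteDimensional ℂ F] (V : M → Type u)
    [TopologicalSpace (TotalSpace F V)] [∀ x, TopologicalSpace (V x)] [∀ x, AddCommGroup (V x)]
    [∀ x, Module ℂ (V x)] [FiberBundle F V] [VectorBundle ℂ F V] [ContMDiffVectorBundle ω F V 𝓘(ℂ, E)]
    (h : HermitianHolomorphicBundle E F V) :
    (SmoothHermitianBundle.ofHolomorphic F V h).rank = finrank ℂ F :=
  rfl

/-- Its Hermitian structure is `h` (definitional). [folklore] -/
theorem SmoothHermitianBundle.ofHolomorphic_metric_inner (F : Type u) [NormedAddCommGroup F]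
    [InnerProductSpace ℂ F] [FiniteDimensional ℂ F] (V : M → Type u)
    [TopologicalSpace (TotalSpace F V)] [∀ x, TopologicalSpace (V x)] [∀ x, AddCommGroup (V x)]
    [∀ x, Module ℂ (V x)] [FiberBundle F V] [VectorBundle ℂ F V] [ContMDiffVectorBundle ω F V 𝓘(ℂ, E)]
    (h : HermitianHolomorphicBundle E F V) (x : M) :
    (SmoothHermitianBundle.ofHolomorphic F V h).metric.inner x = h.inner x :=
  rfl

end Literature.Geometry.Kaehler
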